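import Summits.BirchSwinnertonDyer.Rank1Residual.Partition.CornersAll
import Summits.BirchSwinnertonDyer.Rank1Residual.Partition.MainConjecturesCMAnyOrder
import Summits.BirchSwinnertonDyer.Rank1Residual.Supersingular.RankZeroUpperBoundProp48
import Summits.BirchSwinnertonDyer.Rank1Residual.Supersingular.SharpFlatRankZeroReal
import Summits.BirchSwinnertonDyer.Rank1Residual.Supersingular.GoodSSTowerOfSurj
import Literature.NumberTheory.EllipticCurves.Sprung2024.ChromaticRankZeroOneSidedOfKato
import HarnessLib

/-!
# Leaf X8 (`p = 3` good supersingular, `a_3 = ±3`) — the DISCHARGE INTERFACE of the print tier: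
# leaf predicate `ClassX8 W p` ⟹ the printed hypotheses of the cited theorems, sorry-free
# (cell `bsd-print-x8`, seat ty2; D-0131 (2) PRINT TIER, K3 row A8 = N6 (r0) / O3 (r1), 136 cells)

HONEST FRAMING (run/shared/lean/pub/bsd-print-x8/): THEOREMS ONLY — no definition, no named fact,
no `sorry`, nothing asserted about any curve, nothing booked; class X8 stays CONSTRUCTION-SHAPED.
This file is the cell's ty2 deliverable: for every theorem the print route `PrintX8` may cite BY NAME,
each printed hypothesis is either discharged from the leaf predicate
`Rank1Residual.ClassX8 W p := p = 3 ∧ GoodSS W 3 ∧ a_3 ≠ 0` (plus the sub-leaf datum it genuinely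
needs: `Semistable W`, `Surj W p`, `W.analyticRank = 0 / 1`), or shown to FAIL on the whole leaf, so
that provers close by name and the referee audits hypothesis-by-hypothesis against ONE table.
Lemmas the tree already has are CITED here by name, never restated; only the missing ones are proved.

## The table (printed hypothesis → discharge at an X8 pair → tree declaration)

Curve-level hypotheses shared by the cited theorems (Sprung, Adv. Math. 449 (2024) Cor. 1.2/1.3;
Sprung, JNT 132 (2012) Thms. 7.14/7.16; Perrin-Riou, Exp. Math. 12 (2003) Prop. 4.8; Kobayashi,
Invent. 191 (2013) rem. after Cor. 1.4; Kato, Astérisque 295 (2004) Thm. 12.5 (4)/(12.5.2);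
Castella–Çiperiani–Skinner–Sprung arXiv:1804.10993 Thms. C/D (PRE); Burungale–Skinner–Tian–Wan
arXiv:2409.01350 Thm. 1.5 (PRE); Jetchev–Skinner–Wan 2017 Thm. 1.2.1):
* "`p > 2`" / "`p` odd": `ClassX8.p_ne_two`, `ClassX8.two_lt` (here, §0).
* "`p` of good reduction", "`p ∤ N`": `ClassX8.good` (§0).
* "supersingular", "non-ordinary, `|a_p|_p < 1`", "`p ∣ a_p`": `ClassX8.goodSS`,
  `ClassX8.dvd_frobeniusTrace` (§0); "`a_p ≠ 0`" (the ♯/♭ setting, NOT the `±` one):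
  `ClassX8.frobeniusTrace_ne_zero` (§0); "`a_3 = ±3`": `ClassX8.frobeniusTrace_eq_three_or`
  (`SharpFlatRankZeroReal`, cited) and the literal form of the leaf `classX8_iff_frobeniusTrace_eq` (§1).
* "`E` non-CM": `ClassX8.not_hasCM` (§1, NEW — Deuring: a CM curve with good reduction at an odd
  inert prime has `a_p = 0`, at a split prime it is ordinary; so the partition's reading of corner X8
  under `¬ W.HasCM` loses nothing, `ClassX8.partitionDomain`).
* "square-free conductor" / "semistable": the sub-leaf datum `Semistable W`; in the binder form
  `W.IsSemistable (𝓞 ℚ)` of `Sprung2024.cor12/cor13_…`: `ClassX8.isSemistable_of_semistable` (§0).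
* "`E[p]` irreducible" / "no rational `p`-isogeny": `ClassX8.irr`, `ClassX8.irr'` (`Typed/X8`, cited;
  Serre 1972 Prop. 12, a THEOREM).
* "`ρ̄_{E,p}` surjective": on X8 ∩ {sst} `ClassX8.surj_of_semistable` (`Typed/X8`, cited; Serre 1972
  Prop. 21 i)); off {sst} it is the per-pair datum `Surj W p` (the Borel branch is empty:
  `X8.red_or_surj_iff`, cited).
* Kato's (12.5.2) "`SL₂(ℤ_p) ⊆ ρ(G_{ℚ(μ_{p^∞})})`": `ClassX8.imageContainsSL2_of_surj / _of_semistable`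
  (`RankZeroUpperBoundProp48`, cited; Wuthrich 2014 Lemma 20 PROVED in the tree).
* "`ρ_{E,p^∞}` surjective" (Sprung 2012 Thm. 7.16, integral clause; Kato Thm. 17.4 (3)):
  `ClassX8.towerSurj_of_surj` (`GoodSSTowerOfSurj`, cited) and, binder-free on X8 ∩ {sst},
  `ClassX8.towerSurj_of_semistable_of_surj3` (§3, NEW: no modularity / level-lowering binder, contrast
  `TowerSurjectivitySemistable.ClassX8.towerSurj_of_semistable`).
* "`p ∤ #E(ℚ)_tors`": `ClassX8.not_three_dvd_torsionOrder`, `ClassX8.padicValNat_three_torsionOrder`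
  (`X8Torsion`, cited); "non-anomalous, `a_p ≢ 1`": `ClassX8.not_anomalous` (`SharpFlatKuriharaRoute`, cited).
* "`L(E,1) ≠ 0`" / "`ord_{s=1} L(E,s) = 1`" / "`Ш(E/ℚ)` finite": the sub-leaf datum
  `W.analyticRank = 0 / 1` read through modularity `hasEntireLFunction_rat` and GZK
  `rank_eq_analyticRank_of_analyticRank_le_one` — discharged INSIDE the apply-lemmas of §4.
Provisos that FAIL on the whole leaf (§2): BSTW Thm. 1.5 (h4) "`a_3 = 0` if `p = 3`"
(`ClassX8.not_bstw_h4`); JSW Thm. 1.2.1's `p = 3` clause (`ClassX8.not_jsw_three_clause`); every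
COVERED row C1–C17 of the partition (`ClassX8.not_covered`: no class-level published theorem as the
tree states it reaches an X8 pair); the `±`/`a_p = 0` reading of Kobayashi 2003 / BKO 2024 Cor. A.5
(`ClassX8.frobeniusTrace_ne_zero`). Exclusivity (§2): an X8 pair is in no other corner except X7,
and `ClassX7 W p ↔ ¬ Semistable W` there (`ClassX8.classX7_iff_not_semistable`).
Sibling file `X8PrintClosers.lean` (same seat): the four PUBLISHED one-sided theorems INSTANTIATED
at the leaf (conclusions verbatim), the leaf-wide reduction "on X8 ∩ {sst ∨ surj(3)}, rank ≤ 1, the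
only missing input is the ♯/♭ lower bound", and the PARTITION glue (a class theorem deletes the corner).

References: Sprung 2024 [Sprung2024] Cor. 1.2/1.3 (p. 4–5); Sprung 2012 [Sprung2012] Thms. 7.14,
7.16, Main Conj. 7.21; Perrin-Riou 2003 [PerrinRiou2003] Prop. 4.8; Kobayashi 2013 [Kobayashi2013]
Cor. 1.3, rem. pp. 534–535; Kato 2004 [Kato2004Asterisque] (12.5.2); Wuthrich 2014 [Wuthrich2014]
Lemma 20; Serre 1972 [Serre1972] Props. 12, 21; Lang, *Elliptic Functions* [Lang1987] Ch. 13 §4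
Thm. 12 (Deuring); JSW 2017 [JetchevSkinnerWan2017] Thm. 1.2.1; Miller 2011 [Miller2011LMS] Def. 1.1;
HOME/README.md (cell bsd-print-x8); `Partition/CornersAll.lean`; `Typed/X8.lean`.
-/

noncomputable section

open scoped Classical NumberField

open WeierstrassCurve Literature.NumberTheory.EllipticCurves
  Literature.NumberTheory.EllipticCurves.Rank1Residual
  Literature.NumberTheory.EllipticCurves.Rank1Residual.Typed
  Literature.NumberTheory.EllipticCurves.ModularForms

namespace Summit.BirchSwinnertonDyer.Rank1Residual.Supersingular

variable (W : WeierstrassCurve ℚ) [W.IsElliptic] [W.IsGloballyMinimal] (p : ℕ) [Fact p.Prime]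

/-! ### §0. The class's own data at its prime symbol `p` (`= 3`), in the binder shapes of the cited facts -/

omit [W.IsElliptic] in
/-- "`p > 2`" as `p ≠ 2`: the binder `_hp` of `Sprung2024.cor12/cor13_…`,
`PerrinRiou2003.prop48_…`, `Kobayashi2013.rem13_…`, `Sprung2012.thm714/716_…`. [folklore] -/
theorem ClassX8.p_ne_two (hX : ClassX8 W p) : p ≠ 2 := by
  rw [hX.1]; decide

omit [W.IsElliptic] in
/-- "`p > 2`" verbatim (Sprung 2012 "odd supersingular prime"; Sprung 2024 Thm. 1.1 "`p > 2`";
CCSS §1.1 "`p > 2`"). [folklore] -/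
theorem ClassX8.two_lt (hX : ClassX8 W p) : 2 < p := by
  rw [hX.1]; decide

omit [W.IsElliptic] in
/-- "`p` is a prime of good reduction" (`p ∤ N`): the binder `_hgood`. [folklore] -/
theorem ClassX8.good (hX : ClassX8 W p) : Good W p := by
  obtain ⟨rfl, hss, -⟩ := hX
  exact hss.1

omit [W.IsElliptic] in
/-- "good supersingular at `p`" in the cell's predicate `GoodSS W p` (at the symbol `p`, not the
literal `3`). [folklore] -/
theorem ClassX8.goodSS (hX : ClassX8 W p) : GoodSS W p := by
  obtain ⟨rfl, hss, -⟩ := hX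
  exact hss

omit [W.IsElliptic] in
/-- "supersingular" / "non-ordinary, `|a_p|_p < 1`" as `p ∣ a_p`: the binder `_hss`. [folklore] -/
theorem ClassX8.dvd_frobeniusTrace (hX : ClassX8 W p) : (p : ℤ) ∣ W.frobeniusTrace p :=
  (ClassX8.goodSS W p hX).2

omit [W.IsElliptic] in
/-- "`a_p ≠ 0`" — the ♯/♭ setting of Sprung 2012/2017/2024 ("beyond the case `a_p = 0`"); in
particular the `±`-theory binders "`a_p = 0`" of Kobayashi 2003 Thm. 1.3 / Pollack 2003 /
`BurungaleKobayashiOta2024.corA5_pPart_of_signedCharIdeal_eq` can NOT be instantiated at an X8 pair.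
[folklore] -/
theorem ClassX8.frobeniusTrace_ne_zero (hX : ClassX8 W p) : W.frobeniusTrace p ≠ 0 := by
  obtain ⟨rfl, -, hne⟩ := hX
  exact hne

omit [W.IsGloballyMinimal] in
/-- "square-free conductor" in the binder shape `W.IsSemistable (𝓞 ℚ)` of
`Sprung2024.cor12_padicValRat_bsd_rank_zero_le` / `cor13_…`, from the cell's `Semistable W`
(`semistable_iff_isSemistable_ringOfIntegers`). [folklore] -/
theorem ClassX8.isSemistable_of_semistable (hsst : Semistable W) : W.IsSemistable (𝓞 ℚ) :=
  (semistable_iff_isSemistable_ringOfIntegers W).mp hsst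

/-! ### §1. The leaf is non-CM, lies in the partition's domain, and reads "`a_3 = ±3`" literally -/

/-- **X8 ⟹ non-CM.** A CM curve over `ℚ` with good reduction at the odd prime `3` has `3` split
or inert in its CM field (never ramified: `X12.not_cmRamified_of_hasCM_of_good`); split ⟹ good
ORDINARY (`goodOrd_of_hasCM_of_cmSplit`), inert ⟹ `a_3 = 0`
(`frobeniusTrace_eq_zero_of_hasCM_of_cmInert`) — Deuring, Lang *Elliptic Functions* Ch. 13 §4
Thm. 12, both directions THEOREMS of the tree. An X8 pair has `3 ∣ a_3 ≠ 0`, so neither. Hence the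
partition's reading of corner X8 under `¬ W.HasCM` (`bsdp_allCurves_of_not_corner_of_not_cornerF`)
is the whole class, and the `(hcm : ¬ W.HasCM)` binders of the per-pair X8 consumers
(`ChaDescentRoute`, `ChaIndexRoute`, `JetchevIndexRoute`) are automatic.
[cite: Lang1987, Ch. 13 §4 Thm. 12 (PDF p. 140)] -/
theorem ClassX8.not_hasCM (hX : ClassX8 W p) : ¬ W.HasCM := by
  intro hCM
  obtain ⟨rfl, hss, hne⟩ := hX
  have hin : CMInert W 3 := (goodSS_iff_cmInert_of_hasCM_of_good hCM (by decide) hss.1).mp hss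
  exact hne (frobeniusTrace_eq_zero_of_hasCM_of_cmInert hCM (by decide) hss.1 hin)

omit [W.IsElliptic] in
/-- **X8 lies in the partition's domain**: the hypothesis `hdom` of
`bsdp_allCurves_of_not_corner_of_not_cornerF` ("`W` has CM, or `p` is odd and (good, or
multiplicative with `r = 0`)") holds at every X8 pair through its second disjunct. [folklore] -/
theorem ClassX8.partitionDomain (hX : ClassX8 W p) :
    W.HasCM ∨ (p ≠ 2 ∧ (Good W p ∨ (Mult W p ∧ W.analyticRank = 0))) :=
  Or.inr ⟨ClassX8.p_ne_two W p hX, Or.inl (ClassX8.good W p hX)⟩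

/-- **The leaf, literally as the ladder prints it** ("supersingular at `3` with `a₃ = ±3`"):
`ClassX8 W p ↔ p = 3 ∧ 3 ∤ N ∧ a_3 ∈ {3, −3}` — Hasse's bound via `ClassX8.frobeniusTrace_eq_three_or`.
[cite: SilvermanAEC2009, Thm. V.1.1] -/
theorem classX8_iff_frobeniusTrace_eq :
    ClassX8 W p ↔ p = 3 ∧ Good W 3 ∧ (W.frobeniusTrace 3 = 3 ∨ W.frobeniusTrace 3 = -3) := by
  constructor
  · intro hX
    exact ⟨hX.1, hX.2.1.1, ClassX8.frobeniusTrace_eq_three_or W p hX⟩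
  · rintro ⟨hp3, hgood, h3 | h3⟩
    · exact ⟨hp3, ⟨hgood, by rw [h3]; exact ⟨1, by norm_num⟩⟩, by rw [h3]; decide⟩
    · exact ⟨hp3, ⟨hgood, by rw [h3]; exact ⟨-1, by norm_num⟩⟩, by rw [h3]; decide⟩

/-! ### §2. Exclusivity (boundary police) and the printed provisos that FAIL on the leaf -/

omit [W.IsElliptic] in
/-- X8 is not on the ordinary axis: `¬ GoodOrd W p` (so Skinner–Urban / BCS 2025 / Yan–Zhu /
Greenberg–Vatsal binders `GoodOrd` are never met). [folklore] -/
theorem ClassX8.not_goodOrd (hX : ClassX8 W p) : ¬ GoodOrd W p :=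
  fun h ↦ h.2 (ClassX8.dvd_frobeniusTrace W p hX)

omit [W.IsElliptic] in
/-- X8 is not on the multiplicative axis: `¬ Mult W p` (Skinner 2016 Thm. C's multiplicative
clause, Castella 2018, X2/X11 never apply). [folklore] -/
theorem ClassX8.not_mult (hX : ClassX8 W p) : ¬ Mult W p :=
  not_mult_of_good W p (ClassX8.good W p hX)

omit [W.IsElliptic] in
/-- X8 is not on the additive axis: `¬ Addv W p` (Kim's additive theorems, X3/X4 never apply). [folklore] -/
theorem ClassX8.not_addv (hX : ClassX8 W p) : ¬ Addv W p :=
  fun h ↦ h.1 (ClassX8.good W p hX)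

omit [W.IsElliptic] in
/-- **X8 never meets corner X6** (`ClassX6` demands `5 ≤ p ∨ a_3 = 0`): the X6 road (Kobayashi's `±`
main conjecture; BSTW Thm. 1.3/1.5) and the X8 road are disjoint BY PREDICATE — the kernel form of
prover p3's question "does the X6 road cover `a_p ≠ 0` at `p = 3`?" answered NO at the level of the
typed statements. [folklore] -/
theorem ClassX8.not_classX6 (hX : ClassX8 W p) : ¬ ClassX6 W p := by
  obtain ⟨rfl, -, hne⟩ := hX
  rintro ⟨-, -, h5 | h0⟩
  · omega
  · exact hne h0

omit [W.IsElliptic] in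
/-- **On X8, corner X7 is exactly non-semistability**: `ClassX7 W p ↔ ¬ Semistable W`. So the leaf
splits as X8 ∩ {sst} (Sprung 2024 Cor. 1.2/1.3 apply) ⊔ X8 ∩ X7 (no square-free-conductor theorem
applies; per-pair image data needed). [folklore] -/
theorem ClassX8.classX7_iff_not_semistable (hX : ClassX8 W p) : ClassX7 W p ↔ ¬ Semistable W :=
  ⟨fun h ↦ h.2, fun h ↦ ⟨ClassX8.goodSS W p hX, h⟩⟩

/-- X8 never meets the CM corner X12 (`ClassX8.not_hasCM`). [cite: Lang1987, Ch. 13 §4 Thm. 12 (PDF p. 140)] -/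
theorem ClassX8.not_classX12 (hX : ClassX8 W p) : ¬ ClassX12 W p :=
  fun h ↦ ClassX8.not_hasCM W p hX h.1

/-- X8 never meets the partition's CM corner `CornerF` (`ClassX8.not_hasCM`).
[cite: Lang1987, Ch. 13 §4 Thm. 12 (PDF p. 140)] -/
theorem ClassX8.not_cornerF (hX : ClassX8 W p) : ¬ CornerF W p :=
  fun h ↦ ClassX8.not_hasCM W p hX h.1

/-- X8 never meets X1 / X2 / X3 (all need `E[p]` reducible or a bad `p`), X4 (additive), X5
(`p = 2`), X9 / X10 (ordinary), X11 (multiplicative). [cite: Serre1972, §1.11 Prop. 12] -/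
theorem ClassX8.not_classX1_X2_X3_X4_X5_X9_X10_X11 (hX : ClassX8 W p) :
    ¬ ClassX1 W p ∧ ¬ ClassX2 W p ∧ ¬ ClassX3 W p ∧ ¬ ClassX4 W p ∧ ¬ ClassX5 W p ∧
      ¬ ClassX9 W p ∧ ¬ ClassX10 W p ∧ ¬ ClassX11 W p := by
  have hirr : Irr W p := ClassX8.irr' W p hX
  have hnord : ¬ GoodOrd W p := ClassX8.not_goodOrd W p hX
  refine ⟨fun h ↦ h.2.1 hirr, fun h ↦ h.2.1 hirr, fun h ↦ h.1 hirr,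
    fun h ↦ ClassX8.not_addv W p hX h.2.1, fun h ↦ ClassX8.p_ne_two W p hX h,
    fun h ↦ hnord h.2.1, fun h ↦ ?_, fun h ↦ ClassX8.not_mult W p hX h.1⟩
  obtain ⟨rfl, -, -⟩ := hX
  exact hnord h.2.1

/-- **No COVERED row of the partition reaches an X8 pair** (`Partition/Rows.lean`, rows C1–C17 =
the class-level PUBLISHED theorems as the tree states their hypotheses): C1/C2/C7/C16 need `GoodOrd`
(or `Mult`), C3 = JSW 2017 Thm. 1.2.1 needs `5 ≤ p ∨ (p = 3 ∧ (ord ∨ a_3 = 0))`, C6 needs `E[p]`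
reducible, C8/C10/C17 need CM. So closing the leaf needs a theorem NOT among the covered rows —
the print route's raison d'être, in the kernel. [cite: JetchevSkinnerWan2017, Thm. 1.2.1 (§1.2)]
[cite: Serre1972, §1.11 Prop. 12] [cite: Lang1987, Ch. 13 §4 Thm. 12 (PDF p. 140)] -/
theorem ClassX8.not_covered (hX : ClassX8 W p) : ¬ Covered W p := by
  have hirr : Irr W p := ClassX8.irr' W p hX
  have hnord : ¬ GoodOrd W p := ClassX8.not_goodOrd W p hX
  have hnmult : ¬ Mult W p := ClassX8.not_mult W p hX
  have hncm : ¬ W.HasCM := ClassX8.not_hasCM W p hX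
  have hne : W.frobeniusTrace p ≠ 0 := ClassX8.frobeniusTrace_ne_zero W p hX
  have hp3 : p = 3 := hX.1
  rintro (h | h | h | h | h | h | h | h | h)
  · rcases h.2.2.1 with ho | hm
    · exact hnord ho
    · exact hnmult hm
  · exact hnord h.2.2.1
  · rcases h.2.2.2.2 with h5 | ⟨-, ho | h0⟩
    · omega
    · exact hnord ho
    · exact hne (hp3 ▸ h0)
  · exact h.2.1 hirr
  · exact hnord h.2.2.2.1
  · exact hncm h.1
  · exact hncm h.1
  · exact hnord h.2.1
  · exact hncm h.1

omit [W.IsElliptic] in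
/-- **BSTW arXiv:2409.01350 Thm. 1.5, hypothesis (h4) "(1.7): `a_3 = 0` if `p = 3`" FAILS on the whole
leaf** — in the binder shape `p = 3 → W.frobeniusTrace 3 = 0` of
`BurungaleSkinnerTianWan2024.thm15_pPart_OPEN` (contrast `h4_of_classX6`). So even the announced
X6 discharge never reaches X8 (prover p3's reading "at the page", kernel side).
[cite: Miller2011LMS, Def. 1.1 (shape only; nothing asserted)] -/
theorem ClassX8.not_bstw_h4 (hX : ClassX8 W p) : ¬ (p = 3 → W.frobeniusTrace 3 = 0) :=
  fun h ↦ hX.2.2 (h hX.1)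

omit [W.IsElliptic] in
/-- **JSW 2017 Thm. 1.2.1's `p = 3` proviso FAILS on the leaf**: "if `p = 3` then (1.2) holds
provided `a_p(E) = 0` when `E` has supersingular reduction at `p`" — in the shape of row C3,
`5 ≤ p ∨ (p = 3 ∧ (GoodOrd W p ∨ a_3 = 0))`. So X8 ∩ {sst} ∩ {r_an = 1} is NOT covered by the
Heegner-point road in print. [cite: JetchevSkinnerWan2017, Thm. 1.2.1 (the p = 3 clause)] -/
theorem ClassX8.not_jsw_three_clause (hX : ClassX8 W p) :
    ¬ (5 ≤ p ∨ (p = 3 ∧ (GoodOrd W p ∨ W.frobeniusTrace 3 = 0))) := by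
  have hnord := ClassX8.not_goodOrd W p hX
  obtain ⟨rfl, -, hne⟩ := hX
  rintro (h5 | ⟨-, ho | h0⟩)
  · omega
  · exact hnord ho
  · exact hne h0

/-! ### §3. The `3`-adic tower on X8 ∩ {sst}, binder-free -/

/-- **X8 ∩ {sst}: `ρ̄_{E,3ⁿ}` onto for every `n`, with NO named-fact binder** — Serre 1972 Prop. 21 i)
(`ClassX8.surj_of_semistable`) then Wuthrich 2014 Lemma 20 in the good supersingular case, PROVED
(`ClassX8.towerSurj_of_surj`). This is the hypothesis "`ρ_{E,p^∞} : G_ℚ → GL₂(ℤ_p)` surjective" of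
Sprung 2012 Thm. 7.16 (integral clause, `thm716_sharpFlatCharIdeal_divisibility.integral`) and of
Kato 2004 Thm. 17.4 (3); contrast `TowerSurjectivitySemistable.ClassX8.towerSurj_of_semistable`,
which routes through level-lowering and carries the binders `exists_isNewformOf`,
`diamond1995_refinedSerre`. [cite: Serre1972, §5.4 Prop. 21 i)] [cite: Wuthrich2014, Lemma 20 (p. 399)]
[cite: Sprung2012, Thm. 7.16 (p. 1504)] -/
theorem ClassX8.towerSurj_of_semistable_of_surj3 (hX : ClassX8 W p) (hsst : Semistable W) (n : ℕ) :
    W.HasSurjectiveModNGaloisRep (p ^ n : ℕ) :=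
  ClassX8.towerSurj_of_surj W p hX (hX.1 ▸ ClassX8.surj_of_semistable W p hX hsst) n

end Summit.BirchSwinnertonDyer.Rank1Residual.Supersingular

end
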